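import Mathlib
import Summits.AnomalousDissipation.AnomalousDissipation.Theses.DyadicWallCascade

/-!
# Sketch — first lemmas for the crux ideas on `DyadicWallCascade.DyadicRealisation`
(stmt-AnomalousDissipation-17918; crux-ideate round 1, ideator 1).

Card A `leray-capped-standing-cascade`:
* `GateReduction`   — the wall-blind dissipation floor: if the force is a Leray projection of a
  smooth field `r` (i.e. `f - r` is `L²`-orthogonal to smooth solenoidal fields), the steady zeroth
  law follows from an energy bound and a floor on the TESTED quantity `∫⟪r, u_j⟫` alone.
* `LerayCapping`    — from the Euler half of the antecedent (the hierarchy `(V,Q,C,F)`) build the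
  smooth force `f`, the pump content `r` (vanishing on the wall collar) and the capped limit field
  `ū` with `∫⟪r, ū⟫ = -2F`.
* `TestedWeakRealisation` — the transferred crux `C⁺` for this pair `(f, r)`.

Card B `reynolds-trichotomy-certified-cap`:
* `ViscousResidualDecay` — the tail's small parameter: second derivatives of a hierarchy decay like
  `Z⁻²`, so in inner units the viscous residual of `V` at dyadic level `k` above the cap is
  `O(2^{-k})` relative to inertia.
* `SublayerContraction` — below the cap the force-free cell problem is uniquely solvable
  (small slab Reynolds number `sup‖U‖ · Z_c < π/2`).
-/

namespace Summit.AnomalousDissipation.AnomalousDissipation.Cruxes.DyadicRealisation.Ideas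

open scoped BigOperators Topology InnerProductSpace
open Filter Set MeasureTheory
open Literature.Analysis.FunctionSpaces

local notation "𝕋³" => UnitAddTorus (Fin 3)
local notation "E³" => EuclideanSpace ℝ (Fin 3)

/-- The conclusion of the crux (verbatim `CoherentStates.SteadyZerothLaw`, stmt-0219). -/
def SteadyZerothLawConclusion : Prop :=
  ∃ f : 𝕋³ → E³, Torus.IsSmooth f ∧ Torus.IsDivFree f ∧ Torus.HasZeroMean f ∧
    ∃ (ν : ℕ → ℝ) (u : ℕ → 𝕋³ → E³) (p : ℕ → 𝕋³ → ℝ), (∀ j, 0 < ν j) ∧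
      Filter.Tendsto ν Filter.atTop (nhds 0) ∧
      (∀ j, Torus.IsClassicalNSSolutionOn Set.univ (ν j) (fun _ => f) (fun _ => u j) (fun _ => p j)) ∧
      (∃ E : ℝ, ∀ j, MeasureTheory.integral MeasureTheory.volume (fun x => ‖u j x‖ ^ 2) ≤ E) ∧
      ∃ ε : ℝ, 0 < ε ∧ ∀ j, ε ≤ ν j * Torus.gradNormSq (u j)

/-- `f` is "the Leray projection of `r`": `f - r` is `L²`-orthogonal to every smooth solenoidal
field (so `⟪f, u⟫ = ⟪r, u⟫` for every steady state `u`). -/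
def IsLerayProjectionOf (f r : 𝕋³ → E³) : Prop :=
  ∀ w : 𝕋³ → E³, Torus.IsSmooth w → Torus.IsDivFree w →
    ∫ x, ⟪f x, w x⟫_ℝ = ∫ x, ⟪r x, w x⟫_ℝ

/-- **Card A, first lemma (gate reduction; provable now from `energy_balance`).**
For steady classical states the budget is `ν‖∇u‖² = ∫⟪f,u⟫ = ∫⟪r,u⟫`; hence an energy bound and a
floor on the tested quantity `∫⟪r, u_j⟫` give the steady zeroth law — whatever happens where
`r = 0` (the wall collar) is irrelevant. -/
def GateReduction : Prop :=
  ∀ (f r : 𝕋³ → E³), Torus.IsSmooth f → Torus.IsDivFree f → Torus.HasZeroMean f →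
    Torus.IsSmooth r → IsLerayProjectionOf f r →
    ∀ (ν : ℕ → ℝ) (u : ℕ → 𝕋³ → E³) (p : ℕ → 𝕋³ → ℝ), (∀ j, 0 < ν j) →
      Filter.Tendsto ν Filter.atTop (nhds 0) →
      (∀ j, Torus.IsClassicalNSSolutionOn Set.univ (ν j) (fun _ => f) (fun _ => u j) (fun _ => p j)) →
      (∃ E : ℝ, ∀ j, ∫ x, ‖u j x‖ ^ 2 ≤ E) →
      (∃ ε : ℝ, 0 < ε ∧ ∀ j, ε ≤ ∫ x, ⟪r x, u j x⟫_ℝ) →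
      SteadyZerothLawConclusion

/-- The Euler half of the antecedent: the clause block of `DyadicWallCascade.HalfSpaceHierarchy`
for a given `(V, Q, C, F)` (verbatim). -/
def IsHalfSpaceHierarchy (V : E³ → E³) (Q : E³ → ℝ) (C F : ℝ) : Prop :=
  let H : Set E³ := {X | 0 < X 2}
  let e : Fin 3 → E³ := fun i => EuclideanSpace.single i (1 : ℝ)
  let pt : ℝ × ℝ → E³ := fun q => !₂[q.1, q.2, (1 : ℝ)]
  ContDiffOn ℝ ((⊤ : ℕ∞) : WithTop ℕ∞) V H ∧ ContDiffOn ℝ ((⊤ : ℕ∞) : WithTop ℕ∞) Q H ∧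
    (∀ X ∈ H, ‖V X‖ ≤ C ∧ |Q X| ≤ C) ∧ (∀ X ∈ H, ∑ i : Fin 3, (fderiv ℝ V X (e i)) i = 0) ∧
    (∀ X ∈ H, (fderiv ℝ V X) (V X) + gradient Q X = 0) ∧
    (∀ X ∈ H, V ((2 : ℝ) • X) = V X ∧ Q ((2 : ℝ) • X) = Q X) ∧
    (∀ X : E³, 1 ≤ X 2 → X 2 ≤ 2 →
      V (X + e 0) = V X ∧ V (X + e 1) = V X ∧ Q (X + e 0) = Q X ∧ Q (X + e 1) = Q X) ∧
    (∫ q in Set.Icc (0 : ℝ) 1 ×ˢ Set.Icc (0 : ℝ) 1, (V (pt q)) 2 = 0) ∧ F ≠ 0 ∧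
    (∫ q in Set.Icc (0 : ℝ) 1 ×ˢ Set.Icc (0 : ℝ) 1, (V (pt q)) 2 * (‖V (pt q)‖ ^ 2 / 2 + Q (pt q)) = F)

/-- **Card A, construction lemma (Leray capping).** From a half-space hierarchy build, on the
unit torus: a collar height `h`, a SMOOTH divergence-free mean-zero force `f`, its pump content `r`
(smooth, vanishing on the wall collar `|z| < h/2`, with `f = P r` in the sense of
`IsLerayProjectionOf`) and the capped field `ū` (bounded; equal to `V` above the wall and to its
mirror image below it on the collar; smooth and exactly steady Euler with force `f` off the wall)
whose tested work is `∫⟪r, ū⟫ = -2F`. Construction: `ū = θ(z)·V^mirror + Bogovskiĭ corrector`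
(zero mass flux makes the corrector solvable in the transition band), `r = ū·∇ū + ∇(θ̃ Q^mirror)`
(identically `0` on the collar because `V·∇V + ∇Q = 0`), `f = P r` (smooth: `P` is an order-`0`
multiplier); `∫⟪r,ū⟫` telescopes to the energy flux through the two sides of the wall. -/
def LerayCapping : Prop :=
  ∀ (V : E³ → E³) (Q : E³ → ℝ) (C F : ℝ), IsHalfSpaceHierarchy V Q C F →
    ∃ (h : ℝ) (f r ū : 𝕋³ → E³) (π : E³ → ℝ) (C' : ℝ),
      let σ : E³ → E³ := fun X => X - (2 * X 2) • EuclideanSpace.single (2 : Fin 3) (1 : ℝ)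
      0 < h ∧ h < 1 / 4 ∧
      Torus.IsSmooth f ∧ Torus.IsDivFree f ∧ Torus.HasZeroMean f ∧ Torus.IsSmooth r ∧
      (∀ Y : E³, |Y 2| < h / 2 → Torus.lift r Y = 0) ∧
      IsLerayProjectionOf f r ∧
      (∀ x, ‖ū x‖ ≤ C') ∧
      (∀ Y : E³, 0 < Y 2 → Y 2 < h / 2 → Torus.lift ū Y = V Y) ∧
      (∀ Y : E³, -(h / 2) < Y 2 → Y 2 < 0 → Torus.lift ū Y = σ (V (σ Y))) ∧
      ContDiffOn ℝ ((⊤ : ℕ∞) : WithTop ℕ∞) (Torus.lift ū) {Y | 0 < Y 2 ∧ Y 2 < 1} ∧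
      ContDiffOn ℝ ((⊤ : ℕ∞) : WithTop ℕ∞) π {Y | 0 < Y 2 ∧ Y 2 < 1} ∧
      (∀ Y : E³, 0 < Y 2 → Y 2 < 1 →
        (fderiv ℝ (Torus.lift ū) Y) (Torus.lift ū Y) + gradient π Y = Torus.lift f Y) ∧
      ∫ x, ⟪r x, ū x⟫_ℝ = -2 * F

/-- Zero Reynolds stress of the blow-down through the unit square of the plane `z = 1`
(`τ = ⟨V₃ V_h⟩ = 0`). -/
def HasZeroReynoldsStress (V : E³ → E³) : Prop :=
  let pt : ℝ × ℝ → E³ := fun q => !₂[q.1, q.2, (1 : ℝ)]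
  (∫ q in Set.Icc (0 : ℝ) 1 ×ˢ Set.Icc (0 : ℝ) 1, (V (pt q)) 2 * (V (pt q)) 0 = 0) ∧
    (∫ q in Set.Icc (0 : ℝ) 1 ×ˢ Set.Icc (0 : ℝ) 1, (V (pt q)) 2 * (V (pt q)) 1 = 0)

/-- **The only use of the viscous half of the antecedent (two normalisations).** A bounded,
mirror-symmetric, force-free entire steady Navier–Stokes profile with bounded pressure blowing down
to the hierarchy forces (i) `F < 0`: the horizontally averaged vertical energy flux `J(Z)` is odd,
non-increasing (`J' = -⟨|∇W|²⟩`) and tends to `F` along the blow-down, so `F = J(+∞) ≤ J(0) = 0`,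
and `F ≠ 0`; (ii) `τ = ⟨V₃V_h⟩ = 0`: the averaged horizontal momentum flux is constant in `Z`,
vanishes at the mirror plane, and `⟨W_h⟩(Z) = ⟨W_h⟩(0) + ∫₀^Z ⟨W_hW₃⟩` stays bounded only if the
limit stress `τ` of the blow-down vanishes.  (Refuters rattack-17918 / rattack-18630-g2, paper
level: "energy ⇒ F < 0 forced; horizontal momentum ⇒ ⟨V₃V_h⟩ = 0 necessary".)  Stated through the
route's own support decl `ViscousWallProfile` (= the antecedent of the crux verbatim). -/
def ProfileNormalisations : Prop :=
  Summit.AnomalousDissipation.AnomalousDissipation.Theses.DyadicWallCascade.ViscousWallProfile →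
    ∃ (V : E³ → E³) (Q : E³ → ℝ) (C F : ℝ),
      IsHalfSpaceHierarchy V Q C F ∧ F < 0 ∧ HasZeroReynoldsStress V

/-- **Card A, transferred crux `C⁺` (tested weak realisation away from the wall).** For the capped
pair `(f, r)` of SOME hierarchy there are steady classical states along `ν_j → 0` with bounded
energy whose tested work stays above a positive floor.  `C⁺ ∧ GateReduction ⇒` the conclusion of
`DyadicRealisation` (for every antecedent), and `C⁺` only constrains the states where `r ≠ 0`,
i.e. at distance `≥ h/2` from the wall, against ONE fixed smooth field. -/
def TestedWeakRealisation : Prop :=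
  ∀ (V : E³ → E³) (Q : E³ → ℝ) (C F : ℝ), IsHalfSpaceHierarchy V Q C F → F < 0 →
    HasZeroReynoldsStress V →
    ∀ (h : ℝ) (f r : 𝕋³ → E³), 0 < h → Torus.IsSmooth f → Torus.IsDivFree f →
      Torus.HasZeroMean f → Torus.IsSmooth r → (∀ Y : E³, |Y 2| < h / 2 → Torus.lift r Y = 0) →
      IsLerayProjectionOf f r →
      (∃ ū : 𝕋³ → E³, (∀ Y : E³, 0 < Y 2 → Y 2 < h / 2 → Torus.lift ū Y = V Y) ∧
        ∫ x, ⟪r x, ū x⟫_ℝ = -2 * F) →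
      ∃ (ν : ℕ → ℝ) (u : ℕ → 𝕋³ → E³) (p : ℕ → 𝕋³ → ℝ), (∀ j, 0 < ν j) ∧
        Filter.Tendsto ν Filter.atTop (nhds 0) ∧
        (∀ j, Torus.IsClassicalNSSolutionOn Set.univ (ν j) (fun _ => f) (fun _ => u j)
          (fun _ => p j)) ∧
        (∃ E : ℝ, ∀ j, ∫ x, ‖u j x‖ ^ 2 ≤ E) ∧
        ∃ ε : ℝ, 0 < ε ∧ ∀ j, ε ≤ ∫ x, ⟪r x, u j x⟫_ℝ

/-- Sanity glue (pure logic): the gate reduction and the tested realisation of the capped force of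
the antecedent's hierarchy give the crux.  (Uses `LerayCapping` to produce `(h,f,r,ū)`; the sign
`F < 0` is forced by the viscous half of the antecedent — energy flux identity for bounded `W` —
and is assumed here as the hypothesis `hF`; likewise `τ = 0` as `hτ`.) -/
theorem dyadicRealisation_conclusion_of (hG : GateReduction) (hCap : LerayCapping)
    (hC : TestedWeakRealisation) (V : E³ → E³) (Q : E³ → ℝ) (C F : ℝ)
    (hV : IsHalfSpaceHierarchy V Q C F) (hF : F < 0) (hτ : HasZeroReynoldsStress V) :
    SteadyZerothLawConclusion := by
  obtain ⟨h, f, r, ū, π, C', hh, _hh4, hfs, hfd, hfm, hrs, hr0, hP, _hbd, hV0, _hV1, _hsm, _hπ,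
    _hE, hwork⟩ := hCap V Q C F hV
  obtain ⟨ν, u, p, hν, hν0, hsol, hEn, hε⟩ :=
    hC V Q C F hV hF hτ h f r hh hfs hfd hfm hrs hr0 hP ⟨ū, hV0, hwork⟩
  exact hG f r hfs hfd hfm hrs hP ν u p hν hν0 hsol hEn hε

/-- **Composition check**: the four card-A statements conclude the crux BY NAME. -/
theorem dyadicRealisation_of_cardA (hG : GateReduction) (hCap : LerayCapping)
    (hS : ProfileNormalisations) (hC : TestedWeakRealisation) :
    Summit.AnomalousDissipation.AnomalousDissipation.Theses.DyadicWallCascade.DyadicRealisation := by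
  intro hA
  obtain ⟨V, Q, C, F, hV, hF, hτ⟩ := hS hA
  exact dyadicRealisation_conclusion_of hG hCap hC V Q C F hV hF hτ

/-- **Card B, first lemma (the tail's small parameter).** A hierarchy has `‖D²V(X)‖ ≤ C₂ / (X₂)²`
on the half-space: in inner units `V` is unchanged (degree `0`), so at dyadic level `k` above the
cap (`X₂ ≍ 2^k`) the viscous residual `ΔV` is `O(4^{-k})` while inertia `V·∇V` is `O(2^{-k})` —
the relative size `2^{-k}` of viscosity is the summable small parameter of the upward induction.
(Proof: smooth + band-periodic ⇒ bounded second derivatives on the compact fundamental band;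
dilation invariance rescales them by `Z⁻²`.) -/
def ViscousResidualDecay : Prop :=
  ∀ (V : E³ → E³) (Q : E³ → ℝ) (C F : ℝ), IsHalfSpaceHierarchy V Q C F →
    ∃ C₂ : ℝ, ∀ X : E³, 0 < X 2 →
      ‖fderiv ℝ (fderiv ℝ V) X‖ ≤ C₂ / (X 2) ^ 2 ∧ ‖fderiv ℝ V X‖ ≤ C₂ / (X 2)

/-- A force-free steady Navier–Stokes flow at unit viscosity in the horizontally `L`-periodic
slab `|X₂| < Z_c`, with velocity bound `M` there (inner units; clauses as in the route decls). -/
def IsSlabSteadyNS (L Zc M : ℝ) (U : E³ → E³) (P : E³ → ℝ) : Prop :=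
  let e : Fin 3 → E³ := fun i => EuclideanSpace.single i (1 : ℝ)
  ContDiff ℝ 2 U ∧ ContDiff ℝ 1 P ∧
    (∀ X, U (X + L • e 0) = U X ∧ U (X + L • e 1) = U X ∧ P (X + L • e 0) = P X ∧
      P (X + L • e 1) = P X) ∧
    (∀ X, ∑ i : Fin 3, (fderiv ℝ U X (e i)) i = 0) ∧
    (∀ X, |X 2| < Zc → ‖U X‖ ≤ M) ∧
    (∀ X, |X 2| < Zc → (fderiv ℝ U X) (U X) + gradient P X =
      ∑ i : Fin 3, fderiv ℝ (fun Y => fderiv ℝ U Y (e i)) X (e i))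

/-- **Card B, sublayer lemma (contraction below the cap).** Force-free steady Navier–Stokes at unit
viscosity in a horizontally periodic slab `|X₂| < Z_c` is uniquely determined by its face values
once the slab Reynolds number `M · Z_c` of ONE of the two flows is below `π/2` (energy identity for
the difference `w`, `∫(w·∇w)·U₁ ≤ M‖w‖‖∇w‖`, Poincaré `‖w‖ ≤ (2Z_c/π)‖∂_Z w‖` across the slab).
Below the cap the local Reynolds number halves per level, so the bottom of the ladder is a
contraction and costs nothing. -/
def SublayerContraction : Prop :=
  ∀ (L Zc M M' : ℝ) (U₁ U₂ : E³ → E³) (P₁ P₂ : E³ → ℝ), 0 < L → 0 < Zc → M * Zc < Real.pi / 2 →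
    IsSlabSteadyNS L Zc M U₁ P₁ → IsSlabSteadyNS L Zc M' U₂ P₂ →
    (∀ X, |X 2| = Zc → U₁ X = U₂ X) →
    ∀ X, |X 2| ≤ Zc → U₁ X = U₂ X

/-- **Card B, conjugacy lemma (the cap problem is the same finite problem at every level).**
If the force is an exact gradient on the wall collar `|z| < h/2` (as for the capped force `f = P r`,
`r = 0` there), then in inner units `X = x/ν` the level-`ν` steady state solves FORCE-FREE steady
Navier–Stokes at unit viscosity on the slab `|X₂| < h/(2ν)` (the gradient is absorbed into the
pressure `P + φ(ν·)`): the equations seen by the cap and the crossover levels do not depend on `ν`;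
only the height of the slab and the data entering from above do. -/
def InnerUnitsForceFree : Prop :=
  ∀ (ν h : ℝ) (f u : 𝕋³ → E³) (p φ : 𝕋³ → ℝ), 0 < ν → 0 < h →
    Torus.IsClassicalNSSolutionOn Set.univ ν (fun _ => f) (fun _ => u) (fun _ => p) →
    Torus.IsSmooth φ → (∀ Y : E³, |Y 2| < h / 2 → Torus.lift f Y = -gradient (Torus.lift φ) Y) →
    let e : Fin 3 → E³ := fun i => EuclideanSpace.single i (1 : ℝ)
    let U : E³ → E³ := fun X => Torus.lift u (ν • X)
    let P : E³ → ℝ := fun X => Torus.lift p (ν • X) + Torus.lift φ (ν • X)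
    ∀ X : E³, |X 2| < h / (2 * ν) →
      (fderiv ℝ U X) (U X) + gradient P X = ∑ i : Fin 3, fderiv ℝ (fun Y => fderiv ℝ U Y (e i)) X (e i)

/-- **Card B, shape of the certificate (what the rigorous numerics must deliver for the crossover
block).** Non-degeneracy of a slab solution `(U, P)`: the linearised force-free steady problem at
`U` with homogeneous face data has only the trivial solution (on a bounded periodic slab the
linearisation is Fredholm of index `0`, so injective = invertible; this is exactly what a
radii-polynomial / Newton–Kantorovich certificate proves about a numerically computed block). -/
def LinearisedSlabInjective (L Zc : ℝ) (U : E³ → E³) : Prop :=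
  let e : Fin 3 → E³ := fun i => EuclideanSpace.single i (1 : ℝ)
  ∀ (w : E³ → E³) (q : E³ → ℝ), ContDiff ℝ 2 w → ContDiff ℝ 1 q →
    (∀ X, w (X + L • e 0) = w X ∧ w (X + L • e 1) = w X ∧ q (X + L • e 0) = q X ∧
      q (X + L • e 1) = q X) →
    (∀ X, ∑ i : Fin 3, (fderiv ℝ w X (e i)) i = 0) →
    (∀ X, |X 2| < Zc → (fderiv ℝ U X) (w X) + (fderiv ℝ w X) (U X) + gradient q X =
      ∑ i : Fin 3, fderiv ℝ (fun Y => fderiv ℝ w Y (e i)) X (e i)) →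
    (∀ X, |X 2| = Zc → w X = 0) →
    ∀ X, |X 2| ≤ Zc → w X = 0

end Summit.AnomalousDissipation.AnomalousDissipation.Cruxes.DyadicRealisation.Ideas
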